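import Summits.QuantumFields.YangMills.Theorems.FluctuationComparisonRegPrIntLLargeFieldGasBareOfEnginePackage
import Summits.QuantumFields.YangMills.Theorems.FluctuationComparisonRegPrIntLLargeFieldGasOfTwoGasPackage
import HarnessLib

/-!
# THE REGISTERED LF STUB FROM THE BARE TWO-GAS PACKAGE (G20, px10 lineage, FILE M): ✓FILE E WITHOUT ITS CONTINUITY ROWS (vc)∕(hc) —
# ★★★ `enginePackageBare_of_twoGasBarePackage` and ★★★ `largeFieldFourPtIntCan_of_twoGasBarePackage`

Cell `ym3-torus` (HUMAN RULING D-0037: rung R3 = continuum `SU(2)` Yang–Mills on `T³` — NOT `d = 4`, NOT infinite volume, NOT a mass gap, NOT the Clay problem); width seat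
`ym3-torus-px10` (gen 19); helper of the crux `stmt-QuantumFields-20520` `UnitScaleTilt.FluctuationComparisonRegPrIntL` (`--supports … --as helper`, NOT a proof of it).
THEOREMS ONLY: 0 `def`, 0 `instance`, 0 `notation`, 0 `sorry`, default heartbeats.

WHAT.  The last link of the bare chain ✓FILE J (stub ⟸ ⟨LFG^{ae,bare}∘⟩) ← ✓FILE K (bare knit∕socket) ← ✓FILE L (stub ⟸ bare engine package): the TWO-GAS edition.
§1 ★★★`enginePackageBare_of_twoGasBarePackage` = ✓FILE E §2 with the rows (vc) `∀ X, ContinuousOn (v · X) W_J^{c}` and (hc) `∀ Q′ X, ContinuousOn (h₂ Q′ X ·) W_J^{c}` DELETED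
from the hypothesis and the continuity row DELETED from the conclusion — the proof is FILE E's verbatim, the generic door ✓`engineRows_of_twoGas` being read at the DISCRETE
topology on `SU(2)` (`letI … := ⊥`: its two continuity inputs become vacuous, its continuity output is dropped; nothing else in it sees a topology).  §2
★★★`largeFieldFourPtIntCan_of_twoGasBarePackage : ⟨h2P minus (vc)∕(hc)⟩ → ⟨LargeFieldFourPtIntCan :588 VERBATIM⟩ := largeFieldFourPtIntCan_of_enginePackageBare ∘ §1`.
NET BY NAME: the 𝐑-operation hand's rows at this stub are (cat) (vloc) (vKP) (hloc) (hbd) (num) and the a.e. identity (ID) — NO continuity, NO measurability of the activities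
(the WEAK-form edition keeps measurability: ✓FILE I's `h2W`, whose (vc)∕(hc) could likewise be traded for (vm)∕(hm), not typed here).

HONEST — WHAT THIS IS NOT.  Re-threading; nothing of Bałaban's analysis; the bare two-gas package IS the d = 3 large-field 𝐑-operation in identity form (XL, OPEN, unprinted);
`h2P`∕`h2W`, LF-INT∘, `stub_largeFieldFourPtIntCan`, S2β, the crux 20520 NOT proved; `YM3TorusSU2` NOT proved; finite volume ∕ conditional; the Yang–Mills mass gap (Clay) NOT
proved; rung R3 = YM₃ on `T³` — NOT `d = 4`, NOT infinite volume, NOT a mass gap.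
References: [Balaban1985UV3] CMP 102 (1985) Thm 1 p.257, Thm 2 p.272, (41), (43)–(47) pp.266–267, (67)–(71) pp.273–274; [Balaban1989LargeFieldII] CMP 122 (1989) (1.72) p.379,
(1.90)–(1.91) p.388, (1.97)–(1.101) pp.389–390; [KoteckyPreiss1986] CMP 103 (1986) Theorem p.492 (1), (4), (5).
-/

set_option autoImplicit false

noncomputable section

open Finset MeasureTheory Filter Topology Set
open scoped BigOperators
open Literature.Probability.LatticeModels
open Literature.MathematicalPhysics.QuantumFieldTheory.Balaban1983to89
open Literature.MathematicalPhysics.QuantumFieldTheory.Balaban1983to89.T3ContinuumYM3Torus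
open Literature.MathematicalPhysics.QuantumFieldTheory.Balaban1983to89.T3NestedUnitLaws
open Literature.MathematicalPhysics.QuantumFieldTheory.Balaban1983to89.T3UnitLawDensityEML
open Literature.MathematicalPhysics.QuantumFieldTheory.Balaban1983to89.T3UnitScaleTilt
open Literature.MathematicalPhysics.QuantumFieldTheory.Balaban1983to89.T3TiltDescent
open Literature.MathematicalPhysics.QuantumFieldTheory.Balaban1983to89.T3PrintedRegularMinimiser
open Literature.MathematicalPhysics.QuantumFieldTheory.Balaban1983to89.T3LevelShift
open Literature.MathematicalPhysics.QuantumFieldTheory.Balaban1983to89.Missing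
open Literature.MathematicalPhysics.QuantumFieldTheory.Balaban1983to89.T4Continuum
open scoped Literature.MathematicalPhysics.QuantumFieldTheory.Balaban1983to89.T3OrbitAverage
open Literature.MathematicalPhysics.QuantumFieldTheory.Balaban1983to89.Node00 (touchingGraph SiteTouch)
open Literature.MathematicalPhysics.QuantumFieldTheory.Balaban1983to89.B5Eq118OneStroke (iterBlockOf)
open Literature.MathematicalPhysics.QuantumFieldTheory.BalabanImbrieJaffe1984to88.BIJ85BlockAveragesTorusK (blkIter)
open Literature.MathematicalPhysics.QuantumFieldTheory.Balaban1983to89.B16RatioResummation (IsHoleFamily vacCompat)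
open Summit.QuantumFields.YangMills.Theorems.FluctuationComparisonRegPrIntLWregGlue (heightDensityCan)
open Summit.QuantumFields.YangMills.Theorems.FluctuationComparisonRegPrIntLHistoryPartition (LFLabel histEvent smallFactor smallFactor_pos)
open Summit.QuantumFields.YangMills.Theorems.FluctuationComparisonRegPrIntLLargeFieldGasOfEnginePackage (smallFactor_rescale)
open Summit.QuantumFields.YangMills.Theorems.FluctuationComparisonRegPrIntLLargeFieldGasBudgetSmall (smallFactor_le_exp_neg_sq_mul_coupling)
open Summit.QuantumFields.YangMills.Theorems.FluctuationComparisonRegPrIntLLargeFieldGasEngineOfTwoGas (engineRows_of_twoGas)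
open Summit.QuantumFields.YangMills.Theorems.FluctuationComparisonRegPrIntLLargeFieldGasBlockAnimals (blocks_connected_union sum_exp_neg_blocks_le_one)
open Summit.QuantumFields.YangMills.Theorems.FluctuationComparisonRegPrIntLLargeFieldGasOfTwoGasPackage (smallFactor_add smallFactor_mul_exp_le_half)
open Summit.QuantumFields.YangMills.Theorems.FluctuationComparisonRegPrIntLLargeFieldGasBareOfEnginePackage (largeFieldFourPtIntCan_of_enginePackageBare)

namespace Summit.QuantumFields.YangMills.Theorems.FluctuationComparisonRegPrIntLLargeFieldGasBareOfTwoGas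

/-! ## §1 The bare engine package from the bare two-gas package -/

open Classical in
/-- ★★★ **BARE ENGINE PACKAGE ⟸ BARE TWO-GAS PACKAGE** — ✓FILE E `enginePackage_of_twoGasPackage` with the rows (vc)∕(hc) struck from the hypothesis and the continuity row
struck from the conclusion; same prefix threading (`a := a₂∕2`, `pS ↦ max pS 1`, `γE ↦ min γE (min 1 e^{−max 1 (8∕(a₂b₀²))})`) and the same generic door ✓`engineRows_of_twoGas`,
read at the DISCRETE topology on `SU(2)` so that its continuity inputs are vacuous and its continuity output is dropped.
[cite: Balaban1985UV3, Thm 1 p.257, Thm 2 p.272, (41), (43)-(47) pp.266-267 and (67)-(71) pp.273-274; Balaban1989LargeFieldII, (1.72) p.379, (1.90)-(1.91) p.388 and (1.97)-(1.101) pp.389-390; KoteckyPreiss1986, Theorem p.492 (1), (4), (5)] -/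
theorem enginePackageBare_of_twoGasBarePackage
    (h2P : ∀ (L : ℕ), ∃ μ : ℕ, ∃ a₂ : ℝ, 0 < a₂ ∧ ∃ c₀ : ℝ, 0 < c₀ ∧ c₀ ≤ 1 ∧ ∀ (c : ℝ), 0 < c → c ≤ c₀ → ∃ pS : ℝ, ∀ (b₀ p₀ : ℝ), 0 < b₀ → pS ≤ p₀ → 0 < p₀ →
      ∃ γE : ℝ, 0 < γE ∧ ∀ (F : T3Family) (γ : ℝ), F.L = L → 0 < γ → γ ≤ γE →
        ∀ (J K : ℕ) (hJK : J ≤ K),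
          {U : GaugeField (F.P J) 0 (Matrix.specialUnitaryGroup (Fin 2) ℂ) | PlaqSmall (θBal F.L γ (c * b₀) p₀ J) U} ⊆
            Node00.regSet (fieldMeasure (F.P J) 0 (Matrix.specialUnitaryGroup (Fin 2) ℂ)) (heightDensity F γ hJK Set.univ) →
          (∀ U : GaugeField (F.P J) 0 (Matrix.specialUnitaryGroup (Fin 2) ℂ), PlaqSmall (θBal F.L γ (c * b₀) p₀ J) U →
              0 < heightDensityCan F γ hJK Set.univ U) →
          (∀ U : GaugeField (F.P J) 0 (Matrix.specialUnitaryGroup (Fin 2) ℂ), PlaqSmall (θBal F.L γ (c * b₀) p₀ J) U →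
              0 < heightDensityCan F γ hJK (histGood F ℰp (θBal F.L γ b₀ p₀) K J) U) →
          -- ═══ the two-gas expansion at `(J, K)`: a grain, a vacuum gas, hole activities, and the UNNORMALISED identity ═══
          ∃ μ' : ℕ, μ' ≤ μ ∧ μ' ≤ F.m + J ∧
          ∃ (Λ : Finset (Finset (PBond (F.P J) 0))) (v : GaugeField (F.P J) 0 (Matrix.specialUnitaryGroup (Fin 2) ℂ) → Finset (PBond (F.P J) 0) → ℝ)
            (h₂ : Finset (LFLabel F K J) → Finset (PBond (F.P J) 0) → GaugeField (F.P J) 0 (Matrix.specialUnitaryGroup (Fin 2) ℂ) → ℝ) (τ κ' κh : ℝ),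
            -- the vacuum catalogue: non-empty footprints of touching-connected families of `μ′`-blocks
            (∀ X ∈ Λ, X.Nonempty ∧ ∃ Fc : Finset (Site (F.P J) μ'), ((touchingGraph (SiteTouch (P := F.P J) (j := μ'))).induce (Fc : Set (Site (F.P J) μ'))).Connected ∧
              Fc.biUnion (fun y => Finset.univ.filter (fun b : PBond (F.P J) 0 => iterBlockOf μ' b.src = y)) = X) ∧
            -- vacuum activities: V-local, Kotecký–Preiss (1) with size `τ·#blocks` and decay `κ′·#blocks` (NO continuity)
            (∀ (X : Finset (PBond (F.P J) 0)) (U U' : GaugeField (F.P J) 0 (Matrix.specialUnitaryGroup (Fin 2) ℂ)), (∀ e ∈ X, U e = U' e) → v U X = v U' X) ∧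
            (∀ U ∈ {U : GaugeField (F.P J) 0 (Matrix.specialUnitaryGroup (Fin 2) ℂ) | PlaqSmall (θBal F.L γ (c * b₀) p₀ J) U},
              ∀ σ : Finset (PBond (F.P J) 0), ∑ γ' ∈ Finset.univ.filter (fun γ' : Finset (PBond (F.P J) 0) => polyInc γ' σ),
                |v U γ'| * Real.exp (τ * (((γ'.image (fun b : PBond (F.P J) 0 => iterBlockOf μ' b.src)).card : ℕ) : ℝ) +
                  κ' * (((γ'.image (fun b : PBond (F.P J) 0 => iterBlockOf μ' b.src)).card : ℕ) : ℝ)) ≤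
                τ * (((σ.image (fun b : PBond (F.P J) 0 => iterBlockOf μ' b.src)).card : ℕ) : ℝ)) ∧
            -- hole activities: V-local, one small factor per deep hole and block decay (NO continuity)
            (∀ (Q' : Finset (LFLabel F K J)) (X : Finset (PBond (F.P J) 0)) (U U' : GaugeField (F.P J) 0 (Matrix.specialUnitaryGroup (Fin 2) ℂ)),
              (∀ e ∈ X, U e = U' e) → h₂ Q' X U = h₂ Q' X U') ∧
            (∀ (Q' : Finset (LFLabel F K J)) (X : Finset (PBond (F.P J) 0)) (U : GaugeField (F.P J) 0 (Matrix.specialUnitaryGroup (Fin 2) ℂ)), U ∈ {U : GaugeField (F.P J) 0 (Matrix.specialUnitaryGroup (Fin 2) ℂ) | PlaqSmall (θBal F.L γ (c * b₀) p₀ J) U} →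
              (∀ l ∈ Q', l.1.val < K - J) →
              |h₂ Q' X U| ≤ (∏ l ∈ Q', (if l.1.val < K - J then smallFactor F.L γ b₀ p₀ a₂ (K - l.1.val) else 0)) *
                Real.exp (-(κh * (((X.image (fun b : PBond (F.P J) 0 => iterBlockOf μ' b.src)).card : ℕ) : ℝ)))) ∧
            -- numeric rows: tree decay per block beats the entropy of block animals; the hole decay pays for the attached clusters
            4 + 2 * Real.log 26 ≤ κ' ∧ 0 < τ ∧ κ' + Real.exp (τ / κ') * τ + (2 + 2 * Real.log 26) ≤ κh ∧
            -- THE UNNORMALISED IDENTITY per deep history, a.e. on the window: `ρ(E_Q)·Ξ_v(Λ) = ρ(E_∅)·Σ_S (Π h₂)·Ξ_v(vacCompat Λ S)`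
            (∀ Q : Finset (LFLabel F K J), (∀ l ∈ Q, l.1.val < K - J) →
              ∀ᵐ U ∂fieldMeasure (F.P J) 0 (Matrix.specialUnitaryGroup (Fin 2) ℂ), U ∈ {U : GaugeField (F.P J) 0 (Matrix.specialUnitaryGroup (Fin 2) ℂ) | PlaqSmall (θBal F.L γ (c * b₀) p₀ J) U} →
                (heightDensity F γ hJK (histEvent F (θBal F.L γ b₀ p₀) K J Q) U : ℂ) *
                    polymerPartitionFunction polyInc (fun X => ((v U X : ℝ) : ℂ)) Λ =
                  (heightDensity F γ hJK (histGood F ℰp (θBal F.L γ b₀ p₀) K J) U : ℂ) *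
                    ∑ S ∈ (Finset.univ : Finset (Finset (PBond (F.P J) 0))).powerset.filter
                        (IsHoleFamily (fun X => (∃ l ∈ Q, (⟨siteShift (F.sitesPerDir_eq (m := F.m) (K := K) (j := l.1.val + (K - J - l.1.val)) (m' := F.m) (K' := J) (j' := 0)
              (by have := l.1.isLt; omega)) (blkIter (K - J - l.1.val) l.2.src), l.2.μ⟩ : PBond (F.P J) 0) ∈ X) ∧
                          ∃ Fc : Finset (Site (F.P J) μ'), ((touchingGraph (SiteTouch (P := F.P J) (j := μ'))).induce (Fc : Set (Site (F.P J) μ'))).Connected ∧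
                            Fc.biUnion (fun y => Finset.univ.filter (fun b : PBond (F.P J) 0 => iterBlockOf μ' b.src = y)) = X)
                          (Q.image fun l => (⟨siteShift (F.sitesPerDir_eq (m := F.m) (K := K) (j := l.1.val + (K - J - l.1.val)) (m' := F.m) (K' := J) (j' := 0)
              (by have := l.1.isLt; omega)) (blkIter (K - J - l.1.val) l.2.src), l.2.μ⟩ : PBond (F.P J) 0))),
                      (∏ X ∈ S, ((h₂ (Q.filter fun l => (⟨siteShift (F.sitesPerDir_eq (m := F.m) (K := K) (j := l.1.val + (K - J - l.1.val)) (m' := F.m) (K' := J) (j' := 0)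
              (by have := l.1.isLt; omega)) (blkIter (K - J - l.1.val) l.2.src), l.2.μ⟩ : PBond (F.P J) 0) ∈ X) X U : ℝ) : ℂ)) *
                        polymerPartitionFunction polyInc (fun X => ((v U X : ℝ) : ℂ)) (vacCompat Λ S))) :
    ∀ (L : ℕ), ∃ μ : ℕ, ∃ a : ℝ, 0 < a ∧ ∃ c₀ : ℝ, 0 < c₀ ∧ c₀ ≤ 1 ∧ ∀ (c : ℝ), 0 < c → c ≤ c₀ → ∃ pS : ℝ, ∀ (b₀ p₀ : ℝ), 0 < b₀ → pS ≤ p₀ → 0 < p₀ →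
      ∃ γE : ℝ, 0 < γE ∧ ∀ (F : T3Family) (γ : ℝ), F.L = L → 0 < γ → γ ≤ γE →
        ∀ (J K : ℕ) (hJK : J ≤ K),
          {U : GaugeField (F.P J) 0 (Matrix.specialUnitaryGroup (Fin 2) ℂ) | PlaqSmall (θBal F.L γ (c * b₀) p₀ J) U} ⊆
            Node00.regSet (fieldMeasure (F.P J) 0 (Matrix.specialUnitaryGroup (Fin 2) ℂ)) (heightDensity F γ hJK Set.univ) →
          (∀ U : GaugeField (F.P J) 0 (Matrix.specialUnitaryGroup (Fin 2) ℂ), PlaqSmall (θBal F.L γ (c * b₀) p₀ J) U →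
              0 < heightDensityCan F γ hJK Set.univ U) →
          (∀ U : GaugeField (F.P J) 0 (Matrix.specialUnitaryGroup (Fin 2) ℂ), PlaqSmall (θBal F.L γ (c * b₀) p₀ J) U →
              0 < heightDensityCan F γ hJK (histGood F ℰp (θBal F.L γ b₀ p₀) K J) U) →
          -- ═══ the engine's output at `(J, K)`: a grain and Bałaban's expansion with holes ═══
          ∃ μ' : ℕ, μ' ≤ μ ∧ μ' ≤ F.m + J ∧
          ∃ (Adm : Finset (LFLabel F K J) → Finset (PBond (F.P J) 0) → Prop)
            (ζ : Finset (LFLabel F K J) → Finset (PBond (F.P J) 0) → GaugeField (F.P J) 0 (Matrix.specialUnitaryGroup (Fin 2) ℂ) → ℝ)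
            (ζbar : Finset (LFLabel F K J) → Finset (PBond (F.P J) 0) → ℝ) (κmu : ℝ),
            -- footprint map
            (∀ Q' X, Adm Q' X → Q'.Nonempty ∧
              (∀ l ∈ Q', l.1.val < K - J ∧
              (⟨siteShift (F.sitesPerDir_eq (m := F.m) (K := K) (j := l.1.val + (K - J - l.1.val)) (m' := F.m) (K' := J) (j' := 0)
              (by have := l.1.isLt; omega)) (blkIter (K - J - l.1.val) l.2.src), l.2.μ⟩ : PBond (F.P J) 0) ∈ X) ∧
              ∃ Fc : Finset (Site (F.P J) μ'), ((touchingGraph (SiteTouch (P := F.P J) (j := μ'))).induce (Fc : Set (Site (F.P J) μ'))).Connected ∧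
              Fc.biUnion (fun y => Finset.univ.filter (fun b : PBond (F.P J) 0 => iterBlockOf μ' b.src = y)) = X) ∧
            -- the a.e. ratio identity of the expansion with holes, per deep history, on the window
            (∀ Q : Finset (LFLabel F K J), (∀ l ∈ Q, l.1.val < K - J) →
              ∀ᵐ U ∂fieldMeasure (F.P J) 0 (Matrix.specialUnitaryGroup (Fin 2) ℂ), PlaqSmall (θBal F.L γ (c * b₀) p₀ J) U →
              heightDensity F γ hJK (histEvent F (θBal F.L γ b₀ p₀) K J Q) U =
              heightDensity F γ hJK (histGood F ℰp (θBal F.L γ b₀ p₀) K J) U *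
              ∑ 𝒳 ∈ (Finset.univ : Finset (Finset (PBond (F.P J) 0))).powerset.filter (fun 𝒳 => IsCompatible polyInc 𝒳 ∧
              (∀ l ∈ Q, ∃ X ∈ 𝒳, (⟨siteShift (F.sitesPerDir_eq (m := F.m) (K := K) (j := l.1.val + (K - J - l.1.val)) (m' := F.m) (K' := J)
              (j' := 0) (by have := l.1.isLt; omega)) (blkIter (K - J - l.1.val) l.2.src), l.2.μ⟩ : PBond (F.P J) 0) ∈ X) ∧
              ∀ X ∈ 𝒳, Adm (Q.filter fun l => (⟨siteShift (F.sitesPerDir_eq (m := F.m) (K := K) (j := l.1.val + (K - J - l.1.val))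
              (m' := F.m) (K' := J) (j' := 0) (by have := l.1.isLt; omega)) (blkIter (K - J - l.1.val) l.2.src), l.2.μ⟩ : PBond (F.P J) 0) ∈ X) X),
              ∏ X ∈ 𝒳, ζ (Q.filter fun l => (⟨siteShift (F.sitesPerDir_eq (m := F.m) (K := K) (j := l.1.val + (K - J - l.1.val))
              (m' := F.m) (K' := J) (j' := 0) (by have := l.1.isLt; omega)) (blkIter (K - J - l.1.val) l.2.src), l.2.μ⟩ : PBond (F.P J) 0) ∈ X) X U) ∧
            -- V-local activities with a window-uniform majorant (NO continuity)
            (∀ Q' X (U U' : GaugeField (F.P J) 0 (Matrix.specialUnitaryGroup (Fin 2) ℂ)), Adm Q' X → (∀ e ∈ X, U e = U' e) → ζ Q' X U = ζ Q' X U') ∧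
            (∀ Q' X U, Adm Q' X → PlaqSmall (θBal F.L γ (c * b₀) p₀ J) U → |ζ Q' X U| ≤ ζbar Q' X) ∧
            (∀ Q' X, Adm Q' X → 0 ≤ ζbar Q' X) ∧
            -- the energy bound: one small factor per hole, tree decay per block
            (∀ Q' X, Adm Q' X → ζbar Q' X ≤
              (∏ l ∈ Q', (if l.1.val < K - J then smallFactor F.L γ b₀ p₀ a (K - l.1.val) else 0)) *
              Real.exp (-(κmu * ((X.image (fun b : PBond (F.P J) 0 => iterBlockOf μ' b.src)).card : ℝ)))) ∧
            -- tree decay per block beats the entropy of block animals (a pure number)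
            4 + 2 * Real.log 26 ≤ κmu := by
  intro L
  obtain ⟨μ, a₂, ha₂, c₀, hc₀, hc₀1, H⟩ := h2P L
  refine ⟨μ, a₂ / 2, by positivity, c₀, hc₀, hc₀1, fun c hc hcc₀ => ?_⟩
  obtain ⟨pS, H⟩ := H c hc hcc₀
  refine ⟨max pS 1, fun b₀ p₀ hb hpS hp => ?_⟩
  have hp1 : 1 ≤ p₀ := (le_max_right pS 1).trans hpS
  obtain ⟨γE, hγE, H⟩ := H b₀ p₀ hb ((le_max_left pS 1).trans hpS) hp
  -- the coupling ceiling below which `sf(a₂)·e ≤ sf(a₂∕2)`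
  set T : ℝ := max 1 (8 / (a₂ * b₀ ^ 2)) with hT
  refine ⟨min γE (min 1 (Real.exp (-T))), lt_min hγE (lt_min one_pos (Real.exp_pos _)), fun F γ hFL hγ hγle J K hJK hR hP₁ hP₂ => ?_⟩
  have hγE' : γ ≤ γE := hγle.trans (min_le_left _ _)
  have hγ1 : γ ≤ 1 := hγle.trans ((min_le_right _ _).trans (min_le_left _ _))
  have hγT : γ ≤ Real.exp (-T) := hγle.trans ((min_le_right _ _).trans (min_le_right _ _))
  have hlogγ : T ≤ Real.log γ⁻¹ := by
    rw [Real.log_inv, le_neg, ← Real.exp_le_exp, Real.exp_log hγ]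
    exact hγT
  have hL1 : 1 < F.L := hFL ▸ (hFL ▸ F.hL.2 : 1 < F.L)
  obtain ⟨μ', hμ'μ, hμ'J, Λ, v, h₂, τ, κ', κh, hΛ, hvloc, hKP, hhloc, hhbd, hκ', hτ, hκh, h2g⟩ := H F γ hFL hγ hγE' J K hJK hR hP₁ hP₂
  refine ⟨μ', hμ'μ, hμ'J, ?_⟩
  have hd : 0 < (F.P J).d := by rw [T3Family.P_d]; norm_num
  have hμ'' : μ' ≤ (F.P J).m + (F.P J).K := hμ'J
  have h26 : ((3 ^ (F.P J).d - 1 : ℕ) : ℝ) = 26 := by rw [T3Family.P_d]; norm_num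
  -- the output and input small factors
  have hsf₂ : ∀ l : LFLabel F K J, 0 ≤ (if l.1.val < K - J then smallFactor F.L γ b₀ p₀ a₂ (K - l.1.val) else 0) ∧
      (if l.1.val < K - J then smallFactor F.L γ b₀ p₀ a₂ (K - l.1.val) else 0) ≤ 1 := by
    intro l
    split_ifs
    · refine ⟨(smallFactor_pos _ _ _ _ _ _).le, ?_⟩
      unfold smallFactor
      rw [Real.exp_le_one_iff]
      have : 0 ≤ a₂ * (B10.pFun b₀ p₀ (Real.sqrt (γ * ((F.L : ℝ)⁻¹) ^ (K - l.1.val)))) ^ 2 := by positivity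
      linarith
    · exact ⟨le_rfl, zero_le_one⟩
  have hsf : ∀ l : LFLabel F K J, l.1.val < K - J →
      (if l.1.val < K - J then smallFactor F.L γ b₀ p₀ a₂ (K - l.1.val) else 0) * Real.exp 1 ≤
        (if l.1.val < K - J then smallFactor F.L γ b₀ p₀ (a₂ / 2) (K - l.1.val) else 0) := by
    intro l hl
    rw [if_pos hl, if_pos hl]
    exact smallFactor_mul_exp_le_half hL1 hγ hγ1 hb hp1 ha₂ hlogγ _
  -- the two geometric rows on the `μ′`-blocks (FILE D)
  have hconn := fun (Fc Fc' : Finset (Site (F.P J) μ')) hc hc' hne => blocks_connected_union Fc Fc' hc hc' hne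
  -- the door, instantiated at FILE 9's letters BY UNIFICATION; the rows one at a time (the entropy row through `convert`: its `Finset.filter`
  -- carries a different `Decidable` instance in ✓`sum_exp_neg_blocks_le_one` than in the door's statement)
  -- the generic door's continuity rows are discharged VACUOUSLY at the discrete topology on `SU(2)` (they feed only its continuity output, dropped below)
  letI : TopologicalSpace (Matrix.specialUnitaryGroup (Fin 2) ℂ) := ⊥
  haveI : DiscreteTopology (Matrix.specialUnitaryGroup (Fin 2) ℂ) := ⟨rfl⟩
  have key := engineRows_of_twoGas (fieldMeasure (F.P J) 0 (Matrix.specialUnitaryGroup (Fin 2) ℂ))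
    {U : GaugeField (F.P J) 0 (Matrix.specialUnitaryGroup (Fin 2) ℂ) | PlaqSmall (θBal F.L γ (c * b₀) p₀ J) U}
    (fun l : LFLabel F K J => (⟨siteShift (F.sitesPerDir_eq (m := F.m) (K := K) (j := l.1.val + (K - J - l.1.val)) (m' := F.m) (K' := J) (j' := 0)
              (by have := l.1.isLt; omega)) (blkIter (K - J - l.1.val) l.2.src), l.2.μ⟩ : PBond (F.P J) 0))
    (fun l : LFLabel F K J => l.1.val < K - J) (fun b : PBond (F.P J) 0 => iterBlockOf μ' b.src)
    (fun Fc : Finset (Site (F.P J) μ') => ((touchingGraph (SiteTouch (P := F.P J) (j := μ'))).induce (Fc : Set (Site (F.P J) μ'))).Connected)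
    (fun Q => heightDensity F γ hJK (histEvent F (θBal F.L γ b₀ p₀) K J Q))
    (heightDensity F γ hJK (histGood F ℰp (θBal F.L γ b₀ p₀) K J))
    (fun l : LFLabel F K J => if l.1.val < K - J then smallFactor F.L γ b₀ p₀ (a₂ / 2) (K - l.1.val) else 0)
    (fun l : LFLabel F K J => if l.1.val < K - J then smallFactor F.L γ b₀ p₀ a₂ (K - l.1.val) else 0)
    (τ := τ) (κ' := κ') (κh := κh) (κe := 2 + 2 * Real.log 26) Λ v h₂ ?g1 ?g2 ?g3 ?g4 ?g5 ?g6 ?g7 ?g8 ?g9 ?g10 ?g11 ?g12 ?g13 ?g14 ?g15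
  case g1 => exact hΛ
  case g2 => exact hconn
  case g3 => exact hvloc
  case g4 => exact fun X => continuous_of_discreteTopology.continuousOn
  case g5 => exact hKP
  case g6 => exact hhloc
  case g7 => exact fun Q' X => continuous_of_discreteTopology.continuousOn
  case g8 => exact hhbd
  case g9 =>
    intro b
    convert sum_exp_neg_blocks_le_one hd hμ'' (κe := 2 + 2 * Real.log 26) (by rw [h26]) b using 3
  case g10 => exact hκ'
  case g11 => exact hτ
  case g12 => exact hκh
  case g13 => exact hsf₂
  case g14 => exact hsf
  case g15 => exact h2g
  obtain ⟨Adm, ζ, ζbar, κmu, r1, r2, -, r4, r5, r6, r7, r8⟩ := key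
  exact ⟨Adm, ζ, ζbar, κmu, r1, r2, r4, r5, r6, r7, r8⟩

/-! ## §2 The registered stub from the bare two-gas package -/

open Classical in
/-- ★★★ **THE REGISTERED `LargeFieldFourPtIntCan` (registry v11.4 :588, VERBATIM) FROM THE BARE TWO-GAS PACKAGE** = ✓FILE E's `h2P` with its two continuity rows (vc)∕(hc)
DELETED and every other character identical: `largeFieldFourPtIntCan_of_enginePackageBare ∘ enginePackageBare_of_twoGasBarePackage`.
[cite: Balaban1985UV3, Thm 1 p.257, Thm 2 p.272, (41), (43)-(47) pp.266-267; Balaban1989LargeFieldII, (1.90)-(1.91) p.388 and (1.97)-(1.101) pp.389-390] -/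
theorem largeFieldFourPtIntCan_of_twoGasBarePackage
    (h2P : ∀ (L : ℕ), ∃ μ : ℕ, ∃ a₂ : ℝ, 0 < a₂ ∧ ∃ c₀ : ℝ, 0 < c₀ ∧ c₀ ≤ 1 ∧ ∀ (c : ℝ), 0 < c → c ≤ c₀ → ∃ pS : ℝ, ∀ (b₀ p₀ : ℝ), 0 < b₀ → pS ≤ p₀ → 0 < p₀ →
      ∃ γE : ℝ, 0 < γE ∧ ∀ (F : T3Family) (γ : ℝ), F.L = L → 0 < γ → γ ≤ γE →
        ∀ (J K : ℕ) (hJK : J ≤ K),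
          {U : GaugeField (F.P J) 0 (Matrix.specialUnitaryGroup (Fin 2) ℂ) | PlaqSmall (θBal F.L γ (c * b₀) p₀ J) U} ⊆
            Node00.regSet (fieldMeasure (F.P J) 0 (Matrix.specialUnitaryGroup (Fin 2) ℂ)) (heightDensity F γ hJK Set.univ) →
          (∀ U : GaugeField (F.P J) 0 (Matrix.specialUnitaryGroup (Fin 2) ℂ), PlaqSmall (θBal F.L γ (c * b₀) p₀ J) U →
              0 < heightDensityCan F γ hJK Set.univ U) →
          (∀ U : GaugeField (F.P J) 0 (Matrix.specialUnitaryGroup (Fin 2) ℂ), PlaqSmall (θBal F.L γ (c * b₀) p₀ J) U →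
              0 < heightDensityCan F γ hJK (histGood F ℰp (θBal F.L γ b₀ p₀) K J) U) →
          -- ═══ the two-gas expansion at `(J, K)`: a grain, a vacuum gas, hole activities, and the UNNORMALISED identity ═══
          ∃ μ' : ℕ, μ' ≤ μ ∧ μ' ≤ F.m + J ∧
          ∃ (Λ : Finset (Finset (PBond (F.P J) 0))) (v : GaugeField (F.P J) 0 (Matrix.specialUnitaryGroup (Fin 2) ℂ) → Finset (PBond (F.P J) 0) → ℝ)
            (h₂ : Finset (LFLabel F K J) → Finset (PBond (F.P J) 0) → GaugeField (F.P J) 0 (Matrix.specialUnitaryGroup (Fin 2) ℂ) → ℝ) (τ κ' κh : ℝ),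
            -- the vacuum catalogue: non-empty footprints of touching-connected families of `μ′`-blocks
            (∀ X ∈ Λ, X.Nonempty ∧ ∃ Fc : Finset (Site (F.P J) μ'), ((touchingGraph (SiteTouch (P := F.P J) (j := μ'))).induce (Fc : Set (Site (F.P J) μ'))).Connected ∧
              Fc.biUnion (fun y => Finset.univ.filter (fun b : PBond (F.P J) 0 => iterBlockOf μ' b.src = y)) = X) ∧
            -- vacuum activities: V-local, Kotecký–Preiss (1) with size `τ·#blocks` and decay `κ′·#blocks` (NO continuity)
            (∀ (X : Finset (PBond (F.P J) 0)) (U U' : GaugeField (F.P J) 0 (Matrix.specialUnitaryGroup (Fin 2) ℂ)), (∀ e ∈ X, U e = U' e) → v U X = v U' X) ∧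
            (∀ U ∈ {U : GaugeField (F.P J) 0 (Matrix.specialUnitaryGroup (Fin 2) ℂ) | PlaqSmall (θBal F.L γ (c * b₀) p₀ J) U},
              ∀ σ : Finset (PBond (F.P J) 0), ∑ γ' ∈ Finset.univ.filter (fun γ' : Finset (PBond (F.P J) 0) => polyInc γ' σ),
                |v U γ'| * Real.exp (τ * (((γ'.image (fun b : PBond (F.P J) 0 => iterBlockOf μ' b.src)).card : ℕ) : ℝ) +
                  κ' * (((γ'.image (fun b : PBond (F.P J) 0 => iterBlockOf μ' b.src)).card : ℕ) : ℝ)) ≤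
                τ * (((σ.image (fun b : PBond (F.P J) 0 => iterBlockOf μ' b.src)).card : ℕ) : ℝ)) ∧
            -- hole activities: V-local, one small factor per deep hole and block decay (NO continuity)
            (∀ (Q' : Finset (LFLabel F K J)) (X : Finset (PBond (F.P J) 0)) (U U' : GaugeField (F.P J) 0 (Matrix.specialUnitaryGroup (Fin 2) ℂ)),
              (∀ e ∈ X, U e = U' e) → h₂ Q' X U = h₂ Q' X U') ∧
            (∀ (Q' : Finset (LFLabel F K J)) (X : Finset (PBond (F.P J) 0)) (U : GaugeField (F.P J) 0 (Matrix.specialUnitaryGroup (Fin 2) ℂ)), U ∈ {U : GaugeField (F.P J) 0 (Matrix.specialUnitaryGroup (Fin 2) ℂ) | PlaqSmall (θBal F.L γ (c * b₀) p₀ J) U} →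
              (∀ l ∈ Q', l.1.val < K - J) →
              |h₂ Q' X U| ≤ (∏ l ∈ Q', (if l.1.val < K - J then smallFactor F.L γ b₀ p₀ a₂ (K - l.1.val) else 0)) *
                Real.exp (-(κh * (((X.image (fun b : PBond (F.P J) 0 => iterBlockOf μ' b.src)).card : ℕ) : ℝ)))) ∧
            -- numeric rows: tree decay per block beats the entropy of block animals; the hole decay pays for the attached clusters
            4 + 2 * Real.log 26 ≤ κ' ∧ 0 < τ ∧ κ' + Real.exp (τ / κ') * τ + (2 + 2 * Real.log 26) ≤ κh ∧
            -- THE UNNORMALISED IDENTITY per deep history, a.e. on the window: `ρ(E_Q)·Ξ_v(Λ) = ρ(E_∅)·Σ_S (Π h₂)·Ξ_v(vacCompat Λ S)`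
            (∀ Q : Finset (LFLabel F K J), (∀ l ∈ Q, l.1.val < K - J) →
              ∀ᵐ U ∂fieldMeasure (F.P J) 0 (Matrix.specialUnitaryGroup (Fin 2) ℂ), U ∈ {U : GaugeField (F.P J) 0 (Matrix.specialUnitaryGroup (Fin 2) ℂ) | PlaqSmall (θBal F.L γ (c * b₀) p₀ J) U} →
                (heightDensity F γ hJK (histEvent F (θBal F.L γ b₀ p₀) K J Q) U : ℂ) *
                    polymerPartitionFunction polyInc (fun X => ((v U X : ℝ) : ℂ)) Λ =
                  (heightDensity F γ hJK (histGood F ℰp (θBal F.L γ b₀ p₀) K J) U : ℂ) *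
                    ∑ S ∈ (Finset.univ : Finset (Finset (PBond (F.P J) 0))).powerset.filter
                        (IsHoleFamily (fun X => (∃ l ∈ Q, (⟨siteShift (F.sitesPerDir_eq (m := F.m) (K := K) (j := l.1.val + (K - J - l.1.val)) (m' := F.m) (K' := J) (j' := 0)
              (by have := l.1.isLt; omega)) (blkIter (K - J - l.1.val) l.2.src), l.2.μ⟩ : PBond (F.P J) 0) ∈ X) ∧
                          ∃ Fc : Finset (Site (F.P J) μ'), ((touchingGraph (SiteTouch (P := F.P J) (j := μ'))).induce (Fc : Set (Site (F.P J) μ'))).Connected ∧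
                            Fc.biUnion (fun y => Finset.univ.filter (fun b : PBond (F.P J) 0 => iterBlockOf μ' b.src = y)) = X)
                          (Q.image fun l => (⟨siteShift (F.sitesPerDir_eq (m := F.m) (K := K) (j := l.1.val + (K - J - l.1.val)) (m' := F.m) (K' := J) (j' := 0)
              (by have := l.1.isLt; omega)) (blkIter (K - J - l.1.val) l.2.src), l.2.μ⟩ : PBond (F.P J) 0))),
                      (∏ X ∈ S, ((h₂ (Q.filter fun l => (⟨siteShift (F.sitesPerDir_eq (m := F.m) (K := K) (j := l.1.val + (K - J - l.1.val)) (m' := F.m) (K' := J) (j' := 0)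
              (by have := l.1.isLt; omega)) (blkIter (K - J - l.1.val) l.2.src), l.2.μ⟩ : PBond (F.P J) 0) ∈ X) X U : ℝ) : ℂ)) *
                        polymerPartitionFunction polyInc (fun X => ((v U X : ℝ) : ℂ)) (vacCompat Λ S))) :
    ∀ (L : ℕ), ∃ c₀ : ℝ, 0 < c₀ ∧ c₀ ≤ 1 ∧ ∀ (c : ℝ), 0 < c → c ≤ c₀ → ∃ pS : ℝ, ∀ (b₀ p₀ : ℝ), 0 < b₀ → pS ≤ p₀ → 0 < p₀ →
      ∃ γ₁ : ℝ, 0 < γ₁ ∧ ∃ κ : ℝ, 0 < κ ∧ ∀ (F : T3Family) (γ : ℝ), F.L = L → 0 < γ → γ ≤ γ₁ →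
        ∃ ψ : ℕ → ℝ, (∀ J, 0 ≤ ψ J) ∧ Tendsto (fun J : ℕ => (J : ℝ) * ψ J) atTop (𝓝 0) ∧
          ∀ (ν : ℕ → (j : ℕ) → Measure (GaugeField (F.P j) 0 (Matrix.specialUnitaryGroup (Fin 2) ℂ))),
            (∀ K, ν K K = T4GenFunBounds.gibbsMeasure (F.P K) ((F.scheme ℰp γ).β K)) →
            (∀ K j, j < K → ν K j = Measure.map (descend F ℰp j) (ν K (j + 1))) →
            ∀ (J K : ℕ) (hJK : J ≤ K) (ρ : GaugeField (F.P J) 0 (Matrix.specialUnitaryGroup (Fin 2) ℂ) → ℝ),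
              (∀ U, PlaqSmall (θBal F.L γ (c * b₀) p₀ J) U → 0 < ρ U) →
              ν K J = (fieldMeasure _ _ _).withDensity (fun U => ENNReal.ofReal (ρ U)) →
              ContinuousOn ρ {U | PlaqSmall (θBal F.L γ (c * b₀) p₀ J) U} →
              (∀ U : GaugeField (F.P J) 0 (Matrix.specialUnitaryGroup (Fin 2) ℂ), PlaqSmall (θBal F.L γ (c * b₀) p₀ J) U →
                  0 < heightDensityCan F γ hJK (histGood F ℰp (θBal F.L γ b₀ p₀) K J) U) →
              ∀ (b b' : PBond (F.P J) 0) (U V W Z : GaugeField (F.P J) 0 (Matrix.specialUnitaryGroup (Fin 2) ℂ)),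
                PlaqSmall (θBal F.L γ (c * b₀) p₀ J) U → PlaqSmall (θBal F.L γ (c * b₀) p₀ J) V →
                PlaqSmall (θBal F.L γ (c * b₀) p₀ J) W → PlaqSmall (θBal F.L γ (c * b₀) p₀ J) Z →
                (∀ e, e ≠ b → U e = V e) → (∀ e, e ≠ b' → U e = W e) → (∀ e, e ≠ b' → V e = Z e) → (∀ e, e ≠ b → W e = Z e) →
                |((fun U => Real.log (ρ U) - Real.log (heightDensityCan F γ hJK (histGood F ℰp (θBal F.L γ b₀ p₀) K J) U)) U -
                    (fun U => Real.log (ρ U) - Real.log (heightDensityCan F γ hJK (histGood F ℰp (θBal F.L γ b₀ p₀) K J) U)) V) -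
                  ((fun U => Real.log (ρ U) - Real.log (heightDensityCan F γ hJK (histGood F ℰp (θBal F.L γ b₀ p₀) K J) U)) W -
                    (fun U => Real.log (ρ U) - Real.log (heightDensityCan F γ hJK (histGood F ℰp (θBal F.L γ b₀ p₀) K J) U)) Z)|
                  ≤ ψ J * Real.exp (-(κ * (b.src.tdist b'.src : ℝ))) :=
  largeFieldFourPtIntCan_of_enginePackageBare (enginePackageBare_of_twoGasBarePackage h2P)

end Summit.QuantumFields.YangMills.Theorems.FluctuationComparisonRegPrIntLLargeFieldGasBareOfTwoGas

end
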